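import Summits.QuantumFields.YangMills.Theorems.UnitScaleTiltProp7SPrintDefs
import Summits.QuantumFields.YangMills.Theorems.UnitScaleTiltProp7SPrintIn19Dict
import HarnessLib

/-!
# Route `UnitScaleTilt`, crux K1 child «MinimiserStabilityRegPr» (stmt-QuantumFields-19200), registered stub `stub_prop7From14` (skeleton birth_v7
# cc37a178…; leaf V3), pillar P-V3-A′ — **[Balaban1985Variational] PROPOSITION 2 AT PRINT'S PRESENTATION `S_print` FROM [Balaban1985RegularSpaces]
# THEOREM 2 FOR THE BASED LETTERS** (OWNER RULING g23-№3 (α), (c2)): `B11.Prop2Printed B₁′ B₃ L³ c₁′ (famLG3 L (sPrint L T))` — the TEXT of the v8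
# pillar `stub_PV3A` — from TWO rows, both read on the pullbacks based at the `k`-centre `x₀ = embIter (K−n) 0`: (T2) the existence half of [6]
# Thm 2 at the T³ carrier, regularity rider (3.35) dropped («eventually we will drop it out of the assumptions», [6] p. 82), and (C135) its
# hypothesis (1.35) for `(U₀, U)` from (14) + (18) — the comparison of the [Balaban1985Averaging] (43) averages of the based pullbacks with the
# family's (0.4)-descent on small fields

Cell `ym3-torus` ∕ width seat `ym-ust-19200-w1` (gen 0; D-0149; HUMAN RULING D-0037 — YM₃ on T³ is ladder rung R3, not the Clay problem).  WHY.
Print, p. 280–281: «Configurations U from the space (18), and U₀, satisfy the assumptions (1.33)–(1.35) of this theorem with α₀ = ε₀, α₁ = C₁ε₁ …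
Thus for ε₀, ε₁ sufficiently small, more exactly for ε₀ + C₁ε₁ ≦ c₁, and for an arbitrary configuration U = U′U₀ from (18) there exists exactly one
gauge transformation u satisfying \overline{R₀u}ʲ = 1 … such that U₁ = U′^{u⁻¹} satisfies the conditions (1.36)–(1.39) of [6] … U₁ satisfying the
conditions (19)–(21) with ε₂ ≧ B₁(ε₀ + C₁ε₁)».  This file IS that paragraph at the T³ carrier for `S_print` (`Prop7SPrint.sPrint`, p582426): given
[6] Thm 2 for the based letters (row T2, = `B8Thm2SetupTorus.Thm2SetupSUAt` at `x₀`-translated data by `Prop7BasedTranslate` — its own file) and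
the (1.35) row (C135), Proposition 2 holds at `S_print` with `B₁′ = B₁·M`, `c₁′ = min{c₁/M, e/(1+B₃), 1/(B₁M)}`, `M = (1 + C)(1 + B₃) + 1`.  LOCATED
(why two rows and these constants): (a) GAPS G-B11-A4 — with `U₀ ∈ 𝔘_k(C₁B₃ε₁)` the choice `α₀ = ε₀` needs `C₁B₃ε₁ ≤ ε₀`, not among the standing
assumptions; the file takes `α₀ = ε₀ + C₁B₃ε₁` (both `U₀` and `U` lie in `𝔘_k(α₀)`), whence the factor `1 + B₃`; (b) print's `α₁ = C₁ε₁` reads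
(1.35) «|(U′U₀)‾ᵏ − Ū₀ᵏ| < α₁» in the averaging of [6], while (14) ∕ (18) at the T³ carrier are stated in the family's (0.4)-descent
(`T3TiltDescent.descendTo`); the `ℤᵈ` letters based at the `k`-centre average over centre-to-centre boxes, half a block off the carrier's `blockOf`
partition (CARD-19200-V3-g8 §1(c)), so the two averages of one configuration agree only up to the small-field error `C(ε₀ + C₁B₃ε₁)` (both are
within `O(α₀)` of the straight transporter between the same two centres: [Balaban1985Averaging] (24) ∕ Prop. 1, tree `B7Eq47AveragedBondVsStraight`,
`IterPlaqSmall.dist1_holAt_iter_mul_inv_le`) — row C135, `α₁ = C₁ε₁ + C(ε₀ + C₁B₃ε₁)`.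

WHAT IS PROVED (sorry-free, no definition).  **`prop2Printed_sPrint_of_thm2Based`**: for `B₃ ≥ 0`, `B₁, c₁ > 0`, `C ≥ 0`, `e > 0`, rows (T2) and
(C135) (inline hypotheses, stated below in the tree's letters) ⟹ `∃ B₁′ c₁′ > 0, B11.Prop2Printed B₁′ B₃ L³ c₁′ (famLG3 L (sPrint L T))` — for EVERY
Sect. C–E tail `T` (Prop. 2 reads none of it).  Inside: `Prop7SPrintIn19.in19_of_based136_139` ((19) from (1.36) ∕ (1.39) incl. tracelessness),
`AvgCond` ∕ `CritL` of `S_print` from the chart data `(u, U₁)` and the hypotheses (18) ∕ criticality, `IsLandau` = (1.38) with `A = η⁻¹X`, and the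
native ↔ printed form `T3SectALandauChart.prop2Printed_famLG3_iff_native`.

HONEST SCOPE.  A REDUCTION: [6] Theorem 2 (row T2) is NOT proved here or anywhere in the tree at a curved background (XL; `Thm2SetupSUAt` is an
interface); row (C135) is this seat's next file.  The uniqueness clause of Thm 2 («exactly one») and (1.37) are not used (not part of
`B11.Prop2Printed`; injectivity is `Prop7AxialReprPrint.inj16_print_based`).  Readings = `S_print`'s (R2 criticality; (20) in the (1.30) form;
(1.38) multiplier form).  Count-neutral helper toward stmt-QuantumFields-19200 (`--supports`), not a proof of the stub; nothing continuum ∕ OS ∕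
mass-gap ∕ Clay.

References: T. Bałaban, CMP **102** (1985) 277–309 [Balaban1985Variational] ((14)–(18) p.280, (19)–(21) and Prop. 2 p.281); CMP **99** (1985) 75–102
[Balaban1985RegularSpaces] ((1.29) p.81, (1.33)–(1.38) p.82, (1.39) and Thm 2 p.83, p.82 «eventually we will drop it»); CMP **98** (1985) 17–51
[Balaban1985Averaging] ((24) p.21, (43) p.24, Prop. 1 (51) p.26).
-/

noncomputable section

namespace Summit.QuantumFields.YangMills.Theorems.Prop7SPrintProp2

open scoped Matrix.Norms.L2Operator
open NormedSpace
open Literature.MathematicalPhysics.QuantumFieldTheory.Balaban1983to89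
open Literature.MathematicalPhysics.QuantumFieldTheory.Balaban1983to89.T3ContinuumYM3Torus
open Literature.MathematicalPhysics.QuantumFieldTheory.Balaban1983to89.T3UnitLawDensityEML (ℰp)
open Literature.MathematicalPhysics.QuantumFieldTheory.Balaban1983to89.T3PrintedRegularMinimiser (RegPr regFibrePr mem_regFibrePr_iff)
open Literature.MathematicalPhysics.QuantumFieldTheory.Balaban1983to89.T3PrintedMinimiserExistence (regPr_mono)
open Literature.MathematicalPhysics.QuantumFieldTheory.Balaban1983to89.T3ConstrainedMinimiser (fibre)
open B7Prop1Explicit renaming Site → LSite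
open B8Eq138LandauZd (IsLandau138)
open B8Thm4TorusAt (torusLam)
open B8Thm2TorusAt (C136T C139T Cond135T)
open B10Eq27TorusAxialLog (pull unitsField toUField)
open B11 (Prop2Printed)
open T3Thm1Carrier
open T3Thm1CarrierNative (IsCritR2)
open T3SectALandauChart (ResidFam famLG3 pert emb15 eta eta_pos bgUnits In19 CloseAvg Prop2NativeAt prop2Printed_famLG3_iff_native)
open Summit.QuantumFields.YangMills.Theorems.Prop7SPrint (basePt IsAxialPrint RestrictedPrint AvgCondPrint IsLandauPrint CritLPrint sPrint)
open Summit.QuantumFields.YangMills.Theorems.Prop7SPrintIn19 (in19_of_based136_139)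

variable {L : ℕ}

/-- **[Balaban1985Variational] PROPOSITION 2 AT `S_print` FROM [Balaban1985RegularSpaces] THEOREM 2 FOR THE BASED LETTERS.**  For a block size `L`,
a Sect. C–E tail `T`, constants `B₃ ≥ 0` (the (162) constant of the pillar), `B₁, c₁ > 0` ([6] Thm 2's), `C ≥ 0`, `e > 0` (row C135's), assume:
* (T2) **[6] THM 2, EXISTENCE HALF, FOR PRINT'S BASED LETTERS AT THE T³ CARRIER, (3.35)-FREE**: for every member (`F.L = L`, `n < K`, `k = K − n`,
  `η = L^{−k}`, `x₀ = basePt F n K`), all `α₀, α₁ > 0` with `α₀ + α₁ ≤ c₁`, every background `U₀ ∈ 𝔘_k(α₀)` and `U ∈ 𝔘_k(α₀)` (both clauses of (2),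
  `RegPr` = (1.33)₁ ∕ (1.34)₁ by `regPr_iff_inSpace`) with `U ∈ Ax_k(𝔅_k, U₀)` (based (1.19), `IsAxialPrint`) and (1.35) for the based pullbacks of
  `U₀`, `U′ = UU₀⁻¹` (`Cond135T … α₁`), THERE ARE a gauge transformation `u` with the based restriction (1.29) (`RestrictedPrint`), a perturbation `U₁`
  with `(U₁U₀)^u = U` and a torus one-form `A`, bondwise self-adjoint, with `U₁ = e^{iηA}` bondwise, (1.36) `C136T … B₁ … (α₀ + α₁)` (some Hölder data
  `β₀, B₂, len`), (1.38) `IsLandau138` and (1.39) `C139T … B₁ (α₀ + α₁)` for `(U₀♯_{x₀}, A♯_{x₀})` — the shape of `B8Thm2SetupTorus.Thm2SetupSUAt`'s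
  conclusion read at `x₀` (`Prop7BasedTranslate`);
* (C135) **(1.35) FROM (14) + (18)**: for every member, `U₀ ∈ 𝔘_k(a)` with `|Ū₀ − V| < b` in the family's averaging (`CloseAvg`) and `U` in print's
  regular fibre (6)(ε₀) of `V`, with `ε₀, a ≤ e`: `Cond135T L k (U₀♯_{x₀}) (U′♯_{x₀}) (b + C(ε₀ + a))`.
THEN `∃ B₁′ c₁′ > 0, Prop2Printed B₁′ B₃ L³ c₁′ (famLG3 L (sPrint L T))` — with `B₁′ = B₁M`, `c₁′ = min{c₁/M, e/(1+B₃), 1/(B₁M)}`, `M = (1+C)(1+B₃)+1`;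
print's `α₀ = ε₀` replaced by `ε₀ + C₁B₃ε₁` (GAPS G-B11-A4) and `α₁ = C₁ε₁` by `C₁ε₁ + C(ε₀ + C₁B₃ε₁)` (the two-averaging seam), `C₁ = L³`.
[cite: Balaban1985Variational, Prop. 2 p.281, (14)-(18) p.280, (19)-(21) p.281; Balaban1985RegularSpaces, Thm 2 p.83, (1.33)-(1.38) p.82, (1.39) p.83] -/
theorem prop2Printed_sPrint_of_thm2Based (T : ResidFam L) {B₃ B₁ c₁ C e : ℝ} (hB₃ : 0 ≤ B₃) (hB₁ : 0 < B₁) (hc₁ : 0 < c₁)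
    (hC : 0 ≤ C) (he : 0 < e)
    (hT2 : ∀ (F : T3Family), F.L = L → ∀ (n K : ℕ), n < K → ∀ (α₀ α₁ : ℝ), 0 < α₀ → 0 < α₁ → α₀ + α₁ ≤ c₁ →
      ∀ (U₀ U : GaugeField (F.P K) 0 (Matrix.specialUnitaryGroup (Fin 2) ℂ)),
        RegPr F n K α₀ U₀ → RegPr F n K α₀ U → IsAxialPrint F n K U₀ U →
        Cond135T (F.P K).L (K - n) (pull (bgUnits F K U₀) (basePt F n K)) (pull (bgUnits F K (pert U₀ U)) (basePt F n K)) α₁ →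
        ∃ (u : GaugeTransf (F.P K) 0 (Matrix.specialUnitaryGroup (Fin 2) ℂ))
          (U₁ : GaugeField (F.P K) 0 (Matrix.specialUnitaryGroup (Fin 2) ℂ)) (A : PBond (F.P K) 0 → Matrix (Fin 2) (Fin 2) ℂ),
          RestrictedPrint F n K U₀ u ∧ GaugeField.gaugeAct u (emb15 U₀ U₁) = U ∧ (∀ b : PBond (F.P K) 0, IsSelfAdjoint (A b)) ∧
          (∀ b : PBond (F.P K) 0,
            ((U₁ b : Matrix.specialUnitaryGroup (Fin 2) ℂ) : Matrix (Fin 2) (Fin 2) ℂ) = exp (Complex.I • ((eta F n K) • A b))) ∧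
          (∃ (β₀ B₂ : ℝ) (len : LSite (F.P K).d → ℝ),
            C136T (F.P K).L (K - n) (eta F n K) β₀ B₁ B₂ len (α₀ + α₁) (pull (bgUnits F K U₀) (basePt F n K)) (pull A (basePt F n K))) ∧
          IsLandau138 (F.P K).L (K - n) (eta F n K) (Set.univ : Set (LSite (F.P K).d)) (torusLam (K - n))
            (pull (bgUnits F K U₀) (basePt F n K)) (pull A (basePt F n K)) ∧
          C139T (F.P K).L (K - n) (eta F n K) B₁ (α₀ + α₁) (pull (bgUnits F K U₀) (basePt F n K)) (pull A (basePt F n K)))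
    (h135 : ∀ (F : T3Family), F.L = L → ∀ (n K : ℕ) (hnK : n < K) (ε₀ a b : ℝ)
      (V : GaugeField (F.P n) 0 (Matrix.specialUnitaryGroup (Fin 2) ℂ)) (U₀ U : GaugeField (F.P K) 0 (Matrix.specialUnitaryGroup (Fin 2) ℂ)),
        RegPr F n K a U₀ → CloseAvg F n K hnK.le b V U₀ → U ∈ regFibrePr F n K hnK.le ε₀ V → ε₀ ≤ e → a ≤ e →
        Cond135T (F.P K).L (K - n) (pull (bgUnits F K U₀) (basePt F n K)) (pull (bgUnits F K (pert U₀ U)) (basePt F n K)) (b + C * (ε₀ + a))) :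
    ∃ B₁' c₁' : ℝ, 0 < B₁' ∧ 0 < c₁' ∧ Prop2Printed B₁' B₃ ((L : ℝ) ^ 3) c₁' (famLG3 L (sPrint L T)) := by
  -- the constants
  set M : ℝ := (1 + C) * (1 + B₃) + 1 with hM
  have hM1 : 1 ≤ M := by
    have h0 : 0 ≤ (1 + C) * (1 + B₃) := by positivity
    linarith
  have hM0 : 0 < M := lt_of_lt_of_le one_pos hM1
  refine ⟨B₁ * M, min (c₁ / M) (min (e / (1 + B₃)) (1 / (B₁ * M))), by positivity,
    lt_min (by positivity) (lt_min (by positivity) (by positivity)), ?_⟩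
  rw [prop2Printed_famLG3_iff_native]
  intro F hF n K hnK ε₀ ε₁ ε₂ hε₀ hε₁ hsum hε₂ V U₀ hreg₀ hclose U hU hax hcrit
  -- bookkeeping of the radii: `t = ε₀ + C₁ε₁`, `a = C₁B₃ε₁ ≤ B₃t`, `α₀ = ε₀ + a ≤ (1 + B₃)t`
  set C₁ : ℝ := (L : ℝ) ^ 3 with hC₁
  set t : ℝ := ε₀ + C₁ * ε₁ with ht
  have hC₁0 : 0 ≤ C₁ := by positivity
  have hCε : 0 ≤ C₁ * ε₁ := by positivity
  have ht0 : 0 < t := by positivity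
  have hε₀t : ε₀ ≤ t := by linarith
  have ha : C₁ * B₃ * ε₁ ≤ B₃ * t := by nlinarith
  have htc : t ≤ c₁ / M := hsum.trans (min_le_left _ _)
  have hte : t ≤ e / (1 + B₃) := hsum.trans ((min_le_right _ _).trans (min_le_left _ _))
  have htB : t ≤ 1 / (B₁ * M) := hsum.trans ((min_le_right _ _).trans (min_le_right _ _))
  have htc' : M * t ≤ c₁ := by rw [le_div_iff₀ hM0] at htc; linarith
  have hte' : (1 + B₃) * t ≤ e := by rw [le_div_iff₀ (by positivity)] at hte; linarith
  have htB' : B₁ * M * t ≤ 1 := by rw [le_div_iff₀ (by positivity)] at htB; linarith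
  -- `α₀`, `α₁`
  set α₀ : ℝ := ε₀ + C₁ * B₃ * ε₁ with hα₀
  set α₁ : ℝ := C₁ * ε₁ + C * (ε₀ + C₁ * B₃ * ε₁) with hα₁
  have hα₀pos : 0 < α₀ := by positivity
  have hα₁pos : 0 < α₁ := by
    have : 0 < C₁ * ε₁ := by
      have hL : (0 : ℝ) < (L : ℝ) ^ 3 := by
        have := F.hL.2; rw [← hF]; positivity
      exact mul_pos hL hε₁
    positivity
  have hα₀le : α₀ ≤ (1 + B₃) * t := by nlinarith
  have hs : α₀ + α₁ ≤ M * t := by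
    have h1 : (1 + C) * α₀ ≤ (1 + C) * ((1 + B₃) * t) := mul_le_mul_of_nonneg_left hα₀le (by positivity)
    have h2 : α₀ + α₁ = (1 + C) * α₀ + C₁ * ε₁ := by rw [hα₁]; ring
    rw [h2, hM]; nlinarith
  have hsc₁ : α₀ + α₁ ≤ c₁ := hs.trans htc'
  have hs1 : B₁ * (α₀ + α₁) ≤ 1 := (mul_le_mul_of_nonneg_left hs hB₁.le).trans (by rw [← mul_assoc]; exact htB')
  have hsε₂ : B₁ * (α₀ + α₁) ≤ ε₂ := (mul_le_mul_of_nonneg_left hs hB₁.le).trans (by rw [← mul_assoc]; exact hε₂)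
  -- the data in `𝔘_k(α₀)`
  obtain ⟨hUfib, hregU⟩ := (mem_regFibrePr_iff F).mp hU
  have hregU' : RegPr F n K α₀ U := regPr_mono F (by rw [hα₀]; nlinarith) hregU
  have hreg₀' : RegPr F n K α₀ U₀ := regPr_mono F (by rw [hα₀]; linarith) hreg₀
  -- (1.35) from (14) + (18): row C135 with `a = C₁B₃ε₁`, `b = C₁ε₁`
  have hε₀e : ε₀ ≤ e := hε₀t.trans (le_trans (by nlinarith) hte')
  have hae : C₁ * B₃ * ε₁ ≤ e := ha.trans (le_trans (by nlinarith) hte')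
  have h35 := h135 F hF n K hnK ε₀ (C₁ * B₃ * ε₁) (C₁ * ε₁) V U₀ U hreg₀ hclose hU hε₀e hae
  -- Theorem 2 for the based letters
  obtain ⟨u, U₁, A, hrestr, hgauge, hsa, hexp, ⟨β₀, B₂, len, h36⟩, h38, h39⟩ :=
    hT2 F hF n K hnK α₀ α₁ hα₀pos hα₁pos hsc₁ U₀ U hreg₀' hregU' hax h35
  have hη : 0 < eta F n K := eta_pos F n K
  -- the exponent `X = ηA` of (19)
  refine ⟨u, U₁, fun b => (eta F n K) • A b, hrestr, hgauge, ?_, ?_, ?_, ?_⟩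
  · -- (19)
    exact in19_of_based136_139 F (basePt F n K) hsa hexp h36 h39 hs1 hsε₂
  · -- (20): the configuration `U₁U₀` lies on `Σ_k`, carried by `u` to `U ∈ Ax_k ∩ 𝔅_k(V)`
    intro U₁' hU₁'
    have hU₁eq : U₁' = U₁ := by
      funext b
      exact Subtype.ext ((hU₁' b).trans (hexp b).symm)
    subst hU₁eq
    exact ⟨u, hrestr, by rw [hgauge]; exact hax, by rw [hgauge]; exact hUfib⟩
  · -- (21) = (1.38) for `A = η⁻¹X`
    have hX : (fun b : PBond (F.P K) 0 => (eta F n K)⁻¹ • ((eta F n K) • A b)) = A :=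
      funext fun b => inv_smul_smul₀ hη.ne' (A b)
    show IsLandau138 (F.P K).L (K - n) (eta F n K) (Set.univ : Set (LSite (F.P K).d)) (torusLam (K - n))
      (pull (unitsField (toUField U₀)) (basePt F n K)) (pull (fun b => (eta F n K)⁻¹ • ((eta F n K) • A b)) (basePt F n K))
    rw [hX]
    exact h38
  · -- «U₁ critical in the space (19)–(21)» read through the chart
    exact ⟨u, hrestr, by rw [hgauge]; exact hax, by rw [hgauge]; exact hcrit⟩

end Summit.QuantumFields.YangMills.Theorems.Prop7SPrintProp2

end
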